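import Summits.Ventures.PercRepro.PuncturedLYMTwoCoHypDeficit

/-!
# PercRepro — TWO DISJOINT CO-HYPERPLANES, PART 6: THE EXPLICIT FLOW AND ITS ROW / COLUMN IDENTITIES (p10, gen 35)

Arithmetic only.  The boundary correction of proofs/P10-BOUNDARY-g34.md §2′ has a CLOSED FORM in the deficits of
part 5: on the layer-1 row `(m₁ − 1, b)` the `+B` edges gain `β_b = (L − b)·f²_b/((n − j)·m₁·(m₂ − b))`
(`L = j + 1 − m₁`) and the `+R` edges lose `−γ_b = b·f²_{b−1}/((n − j)·m₁·(m₂ + 1 − b))` (`cBeta`, `cGamma`);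
layer 2 is the mirror image; the corner row `(m₁ − 1, m₂ − 1)` (present iff `m₁ + m₂ = j + 2`) has its `+A`, `+B`
edges forced by the two touched columns and its `+R` edges `cornerR = (1 − twoK/m₁ − twoK/m₂)/(n − m₁ − m₂)`.
The weights `wA`, `wB`, `wR` are the superposition of part 3 corrected on the two layers, and:
* `wA_symm` / `wB_symm` / `wR_symm` — the mirror symmetry `(m₁, m₂, a, b) ↦ (m₂, m₁, b, a)`;
* `row_layer1` / `row_corner` / **`w_row`** — every realisable row sums to `1`
(the first identity hypothesis of `puncturedNMP_two_of_seq`).  The column identities are part 6b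
(PuncturedLYMTwoCoHypCols), positivity is part 7.  Nothing here asserts (SP).
-/

namespace PercRepro.PuncturedLYM

open Finset

/-- `β_b = (j + 1 − m₁ − b)·f²_b/((n − j)·m₁·(m₂ − b))`: the `+B` correction of the layer-1 row `(m₁ − 1, b)`. -/
def cBeta (n j m₁ m₂ b : ℕ) : ℚ :=
  ((j + 1 - m₁ - b : ℕ) : ℚ) * coF n j m₂ b / (((n - j : ℕ) : ℚ) * (m₁ : ℚ) * ((m₂ - b : ℕ) : ℚ))

/-- `γ_b = −b·f²_{b−1}/((n − j)·m₁·(m₂ + 1 − b))`: the `+R` correction of the layer-1 row `(m₁ − 1, b)`. -/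
def cGamma (n j m₁ m₂ b : ℕ) : ℚ :=
  -((b : ℚ) * coF n j m₂ (b - 1)) / (((n - j : ℕ) : ℚ) * (m₁ : ℚ) * ((m₂ + 1 - b : ℕ) : ℚ))

/-- The corner `+R` weight `(1 − twoK/m₁ − twoK/m₂)/(n − m₁ − m₂)`. -/
def cornerR (n j m₁ m₂ : ℕ) : ℚ :=
  (1 - twoK n j m₁ m₂ / (m₁ : ℚ) - twoK n j m₁ m₂ / (m₂ : ℚ)) / ((n - m₁ - m₂ : ℕ) : ℚ)

/-- The `+A` weight (a point of `C₁` added) on the profile `(a, b)`. -/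
def wA (n j m₁ m₂ a b : ℕ) : ℚ :=
  if a + 1 = m₁ then twoK n j m₁ m₂ / (m₁ : ℚ)
  else if b + 1 = m₂ then supA n j m₁ m₂ a b + cBeta n j m₂ m₁ a
  else supA n j m₁ m₂ a b

/-- The `+B` weight (a point of `C₂` added). -/
def wB (n j m₁ m₂ a b : ℕ) : ℚ :=
  if b + 1 = m₂ then twoK n j m₁ m₂ / (m₂ : ℚ)
  else if a + 1 = m₁ then supB n j m₁ m₂ a b + cBeta n j m₁ m₂ b
  else supB n j m₁ m₂ a b

/-- The `+R` weight (a point outside `C₁ ∪ C₂` added). -/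
def wR (n j m₁ m₂ a b : ℕ) : ℚ :=
  if a + 1 = m₁ then
    (if b + 1 = m₂ then cornerR n j m₁ m₂ else supR n j m₁ m₂ a b + cGamma n j m₁ m₂ b)
  else if b + 1 = m₂ then supR n j m₁ m₂ a b + cGamma n j m₂ m₁ a
  else supR n j m₁ m₂ a b

/-! ### The mirror symmetry -/

/-- `twoK` is symmetric in `(m₁, m₂)`. -/
theorem twoK_symm (n j m₁ m₂ : ℕ) : twoK n j m₁ m₂ = twoK n j m₂ m₁ := by
  unfold twoK
  ring

/-- `supA (m₁, m₂) a b = supB (m₂, m₁) b a`. -/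
theorem supA_symm (n j m₁ m₂ a b : ℕ) : supA n j m₁ m₂ a b = supB n j m₂ m₁ b a := by
  unfold supA supB
  ring

/-- `supR` is symmetric under the mirror. -/
theorem supR_symm (n j m₁ m₂ a b : ℕ) : supR n j m₁ m₂ a b = supR n j m₂ m₁ b a := by
  unfold supR
  ring

/-- `cornerR` is symmetric in `(m₁, m₂)`. -/
theorem cornerR_symm (n j m₁ m₂ : ℕ) : cornerR n j m₁ m₂ = cornerR n j m₂ m₁ := by
  unfold cornerR
  rw [twoK_symm, show n - m₁ - m₂ = n - m₂ - m₁ by omega]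
  ring

/-- `wA (m₁, m₂) a b = wB (m₂, m₁) b a`. -/
theorem wA_symm (n j m₁ m₂ a b : ℕ) : wA n j m₁ m₂ a b = wB n j m₂ m₁ b a := by
  unfold wA wB
  rw [twoK_symm, supA_symm]

/-- `wB (m₁, m₂) a b = wA (m₂, m₁) b a`. -/
theorem wB_symm (n j m₁ m₂ a b : ℕ) : wB n j m₁ m₂ a b = wA n j m₂ m₁ b a := by
  rw [wA_symm]

/-- `wR` is symmetric under the mirror. -/
theorem wR_symm (n j m₁ m₂ a b : ℕ) : wR n j m₁ m₂ a b = wR n j m₂ m₁ b a := by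
  unfold wR
  rw [cornerR_symm, supR_symm]
  by_cases h1 : a + 1 = m₁ <;> by_cases h2 : b + 1 = m₂ <;> simp [h1, h2]

/-! ### The ingredients -/

/-- `twoK/m₁ − supA (m₁ − 1) b = (f²_b − (j + 1)·δ₂/m₁)/(n − j)`. -/
theorem twoK_div_sub_supA {n j m₁ m₂ b : ℕ} (hm₁ : 1 ≤ m₁) (hm₁j : m₁ ≤ j) (hn : 2 * j + 1 ≤ n) :
    twoK n j m₁ m₂ / (m₁ : ℚ) - supA n j m₁ m₂ (m₁ - 1) b =
      (coF n j m₂ b - ((j : ℚ) + 1) * coDel n j m₂ / (m₁ : ℚ)) / ((n - j : ℕ) : ℚ) := by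
  have ht := coSeq_top hm₁ hm₁j hn
  have hk := coK_mul_r (m := m₂) hn
  have hm : (0 : ℚ) < (m₁ : ℚ) := by exact_mod_cast hm₁
  have hr : (0 : ℚ) < ((n - j : ℕ) : ℚ) := by
    have : 1 ≤ n - j := by omega
    exact_mod_cast this
  unfold twoK supA coF
  field_simp
  linear_combination (-(((n - j : ℕ) : ℚ))) * ht + hk

/-- `(n − j)·twoK = (j + 1)·(1 − δ₁ − δ₂)`. -/
theorem twoK_mul_r {n j m₁ m₂ : ℕ} (hn : 2 * j + 1 ≤ n) :
    ((n - j : ℕ) : ℚ) * twoK n j m₁ m₂ = ((j : ℚ) + 1) * (1 - coDel n j m₁ - coDel n j m₂) := by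
  have h1 := coK_mul_r (m := m₁) hn
  have h2 := coK_mul_r (m := m₂) hn
  have hr : (0 : ℚ) < ((n - j : ℕ) : ℚ) := by
    have : 1 ≤ n - j := by omega
    exact_mod_cast this
  unfold twoK
  field_simp
  linear_combination h1 + h2

/-! ### The row identities -/

/-- **The layer-1 row `(m₁ − 1, b)`** with `b + 2 ≤ m₂` and `b ≤ j + 1 − m₁` sums to `1`. -/
theorem row_layer1 {n j m₁ m₂ b : ℕ} (hm₁ : 1 ≤ m₁) (hm₁j : m₁ ≤ j) (hm₂ : 1 ≤ m₂) (hm₂j : m₂ ≤ j)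
    (hn : 2 * j + 1 ≤ n) (hb : b + 2 ≤ m₂) (hbL : m₁ + b ≤ j + 1) :
    twoK n j m₁ m₂ / (m₁ : ℚ) + ((m₂ : ℚ) - b) * (supB n j m₁ m₂ (m₁ - 1) b + cBeta n j m₁ m₂ b) +
      ((n : ℚ) - j - 1 - m₂ + b) * (supR n j m₁ m₂ (m₁ - 1) b + cGamma n j m₁ m₂ b) = 1 := by
  have hrow := sup_row hm₁ hm₁j hm₂ hm₂j hn (a := m₁ - 1) (b := b) (by omega) (by omega)
  have hsub := twoK_div_sub_supA (m₂ := m₂) (b := b) hm₁ hm₁j hn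
  have hm1 : ((m₁ - 1 : ℕ) : ℚ) = (m₁ : ℚ) - 1 := by
    rw [Nat.cast_sub hm₁]
    push_cast
    ring
  rw [hm1] at hrow
  have hr : (0 : ℚ) < ((n - j : ℕ) : ℚ) := by
    have : 1 ≤ n - j := by omega
    exact_mod_cast this
  have hm : (0 : ℚ) < (m₁ : ℚ) := by exact_mod_cast hm₁
  have hmb : ((m₂ - b : ℕ) : ℚ) = (m₂ : ℚ) - b := by rw [Nat.cast_sub (by omega)]
  have hmb0 : (0 : ℚ) < (m₂ : ℚ) - b := by
    have : (b : ℚ) + 2 ≤ m₂ := by exact_mod_cast hb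
    linarith
  have hL : ((j + 1 - m₁ - b : ℕ) : ℚ) = (j : ℚ) + 1 - m₁ - b := by
    rw [Nat.cast_sub (by omega), Nat.cast_sub (by omega)]
    push_cast
    ring
  have hE : (n : ℚ) - j - m₁ - m₂ + ((m₁ : ℚ) - 1) + b = (n : ℚ) - j - 1 - m₂ + b := by ring
  rw [hE] at hrow
  -- the correction of the row sums to zero
  have hm₂q : (m₂ : ℚ) ≠ 0 := by
    have : (1 : ℚ) ≤ m₂ := by exact_mod_cast hm₂
    linarith
  have hcorr : (twoK n j m₁ m₂ / (m₁ : ℚ) - supA n j m₁ m₂ (m₁ - 1) b) + ((m₂ : ℚ) - b) * cBeta n j m₁ m₂ b +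
      ((n : ℚ) - j - 1 - m₂ + b) * cGamma n j m₁ m₂ b = 0 := by
    rw [hsub]
    unfold cBeta cGamma
    rw [hL, hmb]
    rcases Nat.eq_zero_or_pos b with h0 | hpos
    · subst h0
      rw [coF_zero (m := m₂) hn]
      simp only [Nat.cast_zero, sub_zero, zero_mul, neg_zero, zero_div, mul_zero, add_zero]
      field_simp
      ring
    · have hcol := coF_col hm₂ hm₂j hn hpos (by omega)
      have hrow2 := coF_row hm₂ hm₂j hn (c := b - 1) (by omega)
      have hb1 : ((b - 1 : ℕ) : ℚ) = (b : ℚ) - 1 := by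
        rw [Nat.cast_sub hpos]
        push_cast
        ring
      rw [hb1] at hrow2
      have hm1b : ((m₂ + 1 - b : ℕ) : ℚ) = (m₂ : ℚ) + 1 - b := by
        rw [Nat.cast_sub (by omega)]
        push_cast
        ring
      rw [hm1b]
      have hm1b0 : (m₂ : ℚ) + 1 - b ≠ 0 := by
        have : (b : ℚ) + 2 ≤ m₂ := by exact_mod_cast hb
        linarith
      have hjb : (j : ℚ) + 1 - b ≠ 0 := by
        have : (b : ℚ) + m₁ ≤ (j : ℚ) + 1 := by exact_mod_cast (show b + m₁ ≤ j + 1 by omega)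
        have : (1 : ℚ) ≤ m₁ := by exact_mod_cast hm₁
        linarith
      have hE0 : (n : ℚ) - j - 1 - m₂ + b ≠ 0 := by
        have : (j : ℚ) + 1 + m₂ ≤ (n : ℚ) := by exact_mod_cast (show j + 1 + m₂ ≤ n by omega)
        have : (1 : ℚ) ≤ b := by exact_mod_cast hpos
        linarith
      have hf : coF n j m₂ b = ((b : ℚ) * coG n j m₂ (b - 1) + ((j : ℚ) + 1) * coDel n j m₂) / ((j : ℚ) + 1 - b) := by
        rw [eq_div_iff hjb]
        linear_combination (-1 : ℚ) * hcol
      have hfb : coF n j m₂ (b - 1) =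
          ((m₂ : ℚ) + 1 - b) * coG n j m₂ (b - 1) / ((n : ℚ) - j - 1 - m₂ + b) := by
        rw [eq_div_iff hE0]
        linear_combination (-1 : ℚ) * hrow2
      rw [hf, hfb]
      field_simp
      ring
  linear_combination hrow + hcorr

/-- **The corner row `(m₁ − 1, m₂ − 1)`** (`m₁ + m₂ = j + 2`) sums to `1`. -/
theorem row_corner {n j m₁ m₂ : ℕ} (hm₁ : 1 ≤ m₁) (hm₁j : m₁ ≤ j) (hm₂ : 1 ≤ m₂) (hm₂j : m₂ ≤ j)
    (hsum : m₁ + m₂ = j + 2) (hn : 2 * j + 1 ≤ n) :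
    twoK n j m₁ m₂ / (m₁ : ℚ) + twoK n j m₁ m₂ / (m₂ : ℚ) + ((n - m₁ - m₂ : ℕ) : ℚ) * cornerR n j m₁ m₂ = 1 := by
  have hρ : (0 : ℚ) < ((n - m₁ - m₂ : ℕ) : ℚ) := by
    have : 1 ≤ n - m₁ - m₂ := by omega
    exact_mod_cast this
  unfold cornerR
  field_simp
  ring

/-- **THE ROW IDENTITY**: every realisable row `(a, b)` (`a < m₁`, `b < m₂`, `a + b ≤ j ≤ a + b + (n − m₁ − m₂)`)
sums to `1`. -/
theorem w_row {n j m₁ m₂ : ℕ} (hm₁ : 2 ≤ m₁) (hm₁j : m₁ ≤ j) (hm₂ : 2 ≤ m₂) (hm₂j : m₂ ≤ j)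
    (hbig : j + 2 ≤ m₁ + m₂) (hn : 2 * j + 1 ≤ n) (a b : ℕ) (ha : a < m₁) (hb : b < m₂) (hab : a + b ≤ j)
    (hab' : j ≤ a + b + (n - m₁ - m₂)) :
    ((m₁ : ℚ) - a) * wA n j m₁ m₂ a b + ((m₂ : ℚ) - b) * wB n j m₁ m₂ a b +
      ((n : ℚ) - j - m₁ - m₂ + a + b) * wR n j m₁ m₂ a b = 1 := by
  by_cases h1 : a + 1 = m₁
  · by_cases h2 : b + 1 = m₂
    · -- the corner
      have hsum : m₁ + m₂ = j + 2 := by omega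
      have hcorner := row_corner (by omega) hm₁j (by omega) hm₂j hsum hn
      unfold wA wB wR
      split_ifs
      have e1 : (m₁ : ℚ) - a = 1 := by
        have : (a : ℚ) + 1 = m₁ := by exact_mod_cast h1
        linarith
      have e2 : (m₂ : ℚ) - b = 1 := by
        have : (b : ℚ) + 1 = m₂ := by exact_mod_cast h2
        linarith
      have e3 : (n : ℚ) - j - m₁ - m₂ + a + b = ((n - m₁ - m₂ : ℕ) : ℚ) := by
        have ha' : (a : ℚ) + 1 = m₁ := by exact_mod_cast h1
        have hb' : (b : ℚ) + 1 = m₂ := by exact_mod_cast h2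
        have hj' : (m₁ : ℚ) + m₂ = (j : ℚ) + 2 := by exact_mod_cast hsum
        rw [show n - m₁ - m₂ = n - (m₁ + m₂) by omega, Nat.cast_sub (by omega)]
        push_cast
        linarith
      rw [e1, e2, e3]
      linear_combination hcorner
    · -- layer 1
      have hlay := row_layer1 (b := b) (by omega) hm₁j (by omega) hm₂j hn (by omega) (by omega)
      unfold wA wB wR
      split_ifs
      have e1 : (m₁ : ℚ) - a = 1 := by
        have : (a : ℚ) + 1 = m₁ := by exact_mod_cast h1
        linarith
      have e3 : (n : ℚ) - j - m₁ - m₂ + a + b = (n : ℚ) - j - 1 - m₂ + b := by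
        have ha' : (a : ℚ) + 1 = m₁ := by exact_mod_cast h1
        linarith
      have ha1 : a = m₁ - 1 := by omega
      subst ha1
      rw [e1, e3]
      linear_combination hlay
  · by_cases h2 : b + 1 = m₂
    · -- layer 2: the mirror image of layer 1
      have hlay := row_layer1 (n := n) (j := j) (m₁ := m₂) (m₂ := m₁) (b := a) (by omega) hm₂j (by omega) hm₁j hn
        (by omega) (by omega)
      have e2 : (m₂ : ℚ) - b = 1 := by
        have : (b : ℚ) + 1 = m₂ := by exact_mod_cast h2
        linarith
      have e3 : (n : ℚ) - j - m₁ - m₂ + a + b = (n : ℚ) - j - 1 - m₁ + a := by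
        have hb' : (b : ℚ) + 1 = m₂ := by exact_mod_cast h2
        linarith
      have hb1 : b = m₂ - 1 := by omega
      subst hb1
      rw [wA_symm n j m₁ m₂ a (m₂ - 1), wB_symm n j m₁ m₂ a (m₂ - 1), wR_symm n j m₁ m₂ a (m₂ - 1)]
      unfold wA wB wR
      split_ifs
      rw [e2, e3]
      linear_combination hlay
    · -- the interior
      have hrow := sup_row (by omega) hm₁j (by omega) hm₂j hn ha hb
      unfold wA wB wR
      split_ifs
      exact hrow

end PercRepro.PuncturedLYM
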